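import Mathlib.Analysis.Calculus.LineDeriv.IntegrationByParts
import Summits.NavierStokesRegularity.NavierStokesRegularity.Theses.TypeICertificateLadder
import Summits.NavierStokesRegularity.NavierStokesRegularity.Theorems.AdaptedKernelExists.Negative.GalileanCalibration
import Literature.Analysis.FluidPDE.TypeIAncientMildClassical
import Literature.Analysis.FluidPDE.AncientSimilarityVariables
import Literature.Analysis.FluidPDE.PineauVicolGaussSobolev

/-!
# `Target` (stmt-NavierStokesRegularity-1217), line `head-flux-channel`:
# the head-influx law `stub_headInfluxLaw` (S4) is FALSE WITHOUT the Oseen-mild clause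

Negative lemma for the crux work on `TypeICertificateLadder.NoTypeIBlowup` (drefute seat
refuter-drefute-stmt-NavierStokesRegularity-1217-0, 2026-08-16), supporting the line skeleton
`Cruxes/Target/Lines/head-flux-channel.lean`. No conclusion asserts a route item; no definitions.

The skeleton's load-bearing stub S4 `stub_headInfluxLaw` says: for every Type-I ancient mild
field `u` (`IsTypeIAncientMild C u` = jointly smooth on `t < 0` ∧ divergence free ∧ OSEEN-MILD
between all pairs of negative times ∧ `‖u(t,x)‖ ≤ C/√(-t)`) with a classical pressure `p` on
`(-∞,0)`, the Gaussian head influx `-½Ch` supplies at most the fraction `1 - ε` of the Gaussian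
budget `D + E` on long similarity-time windows.

**Finding.** Delete ONLY the Oseen-mild conjunct and the statement is false at EVERY level
`C > 0`: the self-similar member of the parasitic family of Koch–Nadirashvili–Seregin–Šverák
(2009, §1 p. 3), `u(t,x) = C(-t)^{-1/2} e`, `p(t,x) = -(C/2)(-t)^{-3/2}⟪e, x⟫` — in the tree's
vocabulary `uniformVel (galAmp C 0) e`, `uniformPres (derivWithin (galAmp C 0) (Iio 0)) e` of
`Theorems/AdaptedKernelExists/Negative/` — is jointly smooth on `t < 0`, divergence free, a classical
Navier–Stokes solution on `(-∞,0)` (unit viscosity, no force) and has EXACTLY the Type-I rate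
`‖u(t,x)‖ = C‖e‖/√(-t)`; in similarity variables it is the steady Leray profile `U ≡ C e`,
`P = -(C/2)⟪e, y⟫` (`lerayOrbit_drift`, `lerayOrbitPressure_drift`), whose Gaussian functionals are
`E = ½C²‖e‖² ∫γ`, `D = 0`, `Ch = -C²‖e‖² ∫γ` (`γ = e^{-|y|²/4}`), so that `-½Ch = D + E`
IDENTICALLY (`budget_saturated_drift`): the influx saturates the budget with equality, the law
fails for every `ε > 0` and every window length (`law_fails_drift`), while the Gaussian energy
identity S2c `E' = -D - E - ½Ch` holds (`energyIdentity_drift`, a sign check of the skeleton's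
lever (GE)). The field fails precisely the deleted clause (`not_isTypeIAncientMild_drift`, from the
tree's `IsTypeIAncientMild.eq_zero_of_slice_const`: the Oseen gauge kills slice-constant fields).

Consequences recorded for the lead (evidence note `StubHeadInfluxLaw.md` on the item): any proof
of S4 — INCLUDING its small-`C` "rung" sub-case — must use the Oseen representation, and it must
do so through the PRESSURE: for the witness the kinetic part of the channel vanishes
(`∫ ½‖U‖²⟪y,U⟫γ = 0`) and the whole influx is carried by the harmonic, linear pressure mode
`P = -(C/2)⟪e,y⟫`, which is exactly what the mild representation `p = RᵢRⱼ(uᵢuⱼ) + c(t)` excludes.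
A Gaussian-shell pressure split that tolerates a harmonic remainder `∇h(s)·y` cannot prove S4 at
any `C`.

Contents: Gaussian first/second directional moments on `ℝ³` by integration by parts
(`integral_inner_mul_gaussWeight`, `integral_inner_sq_mul_gaussWeight`:
`∫⟪e,y⟫γ = 0`, `∫⟪e,y⟫²γ = 2‖e‖²∫γ`), the witness and its functionals, the failure of the law,
and the main theorem `stub_headInfluxLaw_false_without_mild`.

[cite: KochNadirashviliSereginSverak2009, §1 p. 3 (parasitic solutions `u = b(t)`, `p = -b'(t)·x`) and Remark 6.1]
-/

noncomputable section

namespace Summit.NavierStokesRegularity.NavierStokesRegularity.Theorems.TargetNegative.HeadInfluxLawDrift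

open MeasureTheory Set Filter Topology Function
open scoped RealInnerProductSpace ContDiff
open Literature.Analysis.FluidPDE
open Literature.Analysis.FluidPDE.PineauVicol2026
open Summit.NavierStokesRegularity.NavierStokesRegularity.Theorems.AdaptedKernelExistsNegative.UniformDrift
open Summit.NavierStokesRegularity.NavierStokesRegularity.Theorems.AdaptedKernelExistsNegative.Galilean

set_option linter.dupNamespace false

/-! ### Gaussian directional moments on `ℝ³` -/

/-- The skeleton's weight is the tree's `gaussWeight`. [folklore] -/
theorem exp_eq_gaussWeight (y : EuclideanSpace ℝ (Fin 3)) : Real.exp (-‖y‖ ^ 2 / 4) = gaussWeight y :=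
  rfl

/-- `‖y‖ γ(y)` is integrable. [folklore] -/
theorem integrable_norm_mul_gaussWeight :
    Integrable (fun y : EuclideanSpace ℝ (Fin 3) => ‖y‖ * gaussWeight y) := by
  have h := integrable_one_add_norm_pow_mul_exp_neg_mul_sq (E := EuclideanSpace ℝ (Fin 3))
    (c := 1 / 4) (by norm_num) 1
  refine h.mono' (continuous_norm.mul continuous_gaussWeight).aestronglyMeasurable
    (Eventually.of_forall fun y => ?_)
  rw [Real.norm_of_nonneg (mul_nonneg (norm_nonneg _) (gaussWeight_pos y).le), gaussWeight_eq,
    pow_one]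
  exact mul_le_mul_of_nonneg_right (by linarith [norm_nonneg y]) (Real.exp_pos _).le

/-- `⟪e, y⟫ γ(y)` is integrable. [folklore] -/
theorem integrable_inner_mul_gaussWeight (e : EuclideanSpace ℝ (Fin 3)) :
    Integrable (fun y : EuclideanSpace ℝ (Fin 3) => ⟪e, y⟫ * gaussWeight y) := by
  refine (integrable_norm_mul_gaussWeight.const_mul ‖e‖).mono'
    ((continuous_const.inner continuous_id).mul continuous_gaussWeight).aestronglyMeasurable
    (Eventually.of_forall fun y => ?_)
  rw [norm_mul, Real.norm_of_nonneg (gaussWeight_pos y).le, ← mul_assoc]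
  exact mul_le_mul_of_nonneg_right (norm_inner_le_norm e y) (gaussWeight_pos y).le

/-- `⟪e, y⟫² γ(y)` is integrable. [folklore] -/
theorem integrable_inner_sq_mul_gaussWeight (e : EuclideanSpace ℝ (Fin 3)) :
    Integrable (fun y : EuclideanSpace ℝ (Fin 3) => ⟪e, y⟫ ^ 2 * gaussWeight y) := by
  refine (integrable_norm_sq_mul_gaussWeight.const_mul (‖e‖ ^ 2)).mono'
    (((continuous_const.inner continuous_id).pow 2).mul continuous_gaussWeight).aestronglyMeasurable
    (Eventually.of_forall fun y => ?_)
  rw [norm_mul, Real.norm_of_nonneg (gaussWeight_pos y).le, ← mul_assoc, norm_pow, ← mul_pow]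
  refine mul_le_mul_of_nonneg_right ?_ (gaussWeight_pos y).le
  exact pow_le_pow_left₀ (norm_nonneg _) (norm_inner_le_norm e y) 2

/-- `0 < ∫ γ`. [folklore] -/
theorem integral_gaussWeight_pos : 0 < ∫ y : EuclideanSpace ℝ (Fin 3), gaussWeight y :=
  integral_exp_pos integrable_gaussWeight

/-- **Vanishing first directional moment** `∫ ⟪e, y⟫ γ(y) dy = 0`, by integration by parts
against `∂_e γ = -½⟪y, e⟫γ`. [folklore] -/
theorem integral_inner_mul_gaussWeight (e : EuclideanSpace ℝ (Fin 3)) :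
    ∫ y : EuclideanSpace ℝ (Fin 3), ⟪e, y⟫ * gaussWeight y = 0 := by
  have key := integral_mul_fderiv_eq_neg_fderiv_mul_of_integrable
    (μ := (volume : Measure (EuclideanSpace ℝ (Fin 3))))
    (f := fun _ : EuclideanSpace ℝ (Fin 3) => (1 : ℝ)) (g := gaussWeight) (v := e) ?_ ?_ ?_
    (fun x _ => differentiableAt_const _) (fun x _ => (hasFDerivAt_gaussWeight x).differentiableAt)
  · simp only [fderiv_fun_const, Pi.zero_apply, _root_.zero_apply, zero_mul,
      integral_zero, neg_zero, one_mul] at key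
    simp_rw [fderiv_gaussWeight_apply] at key
    have h2 : ∫ y : EuclideanSpace ℝ (Fin 3), -(1 / 2 : ℝ) * gaussWeight y * ⟪y, e⟫ =
        -(1 / 2 : ℝ) * ∫ y : EuclideanSpace ℝ (Fin 3), ⟪e, y⟫ * gaussWeight y := by
      rw [← integral_const_mul]
      refine integral_congr_ae (Eventually.of_forall fun y => ?_)
      simp only [real_inner_comm e y]
      ring
    rw [h2] at key
    linarith
  · simp only [fderiv_fun_const, Pi.zero_apply, _root_.zero_apply, zero_mul]
    exact integrable_zero _ _ _
  · simp_rw [one_mul, fderiv_gaussWeight_apply]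
    refine ((integrable_inner_mul_gaussWeight e).const_mul (-(1 / 2 : ℝ))).congr
      (Eventually.of_forall fun y => ?_)
    simp only [real_inner_comm e y]
    ring
  · simpa only [one_mul] using (integrable_gaussWeight (E := EuclideanSpace ℝ (Fin 3)))

/-- `D(y ↦ ⟪e, y⟫) = ⟪e, ·⟫`. [folklore] -/
theorem fderiv_inner_right_apply (e x v : EuclideanSpace ℝ (Fin 3)) :
    fderiv ℝ (fun y : EuclideanSpace ℝ (Fin 3) => ⟪e, y⟫) x v = ⟪e, v⟫ := by
  have hf : (fun y : EuclideanSpace ℝ (Fin 3) => ⟪e, y⟫) = fun y => (innerSL ℝ e) y := by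
    funext y; simp
  rw [hf, ContinuousLinearMap.fderiv]
  simp

/-- **Second directional moment** `∫ ⟪e, y⟫² γ(y) dy = 2‖e‖² ∫ γ` (variance `2` per direction),
by integration by parts of `⟪e, y⟫` against `∂_e γ = -½⟪y, e⟫γ`. [folklore] -/
theorem integral_inner_sq_mul_gaussWeight (e : EuclideanSpace ℝ (Fin 3)) :
    ∫ y : EuclideanSpace ℝ (Fin 3), ⟪e, y⟫ ^ 2 * gaussWeight y =
      2 * ‖e‖ ^ 2 * ∫ y : EuclideanSpace ℝ (Fin 3), gaussWeight y := by
  have key := integral_mul_fderiv_eq_neg_fderiv_mul_of_integrable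
    (μ := (volume : Measure (EuclideanSpace ℝ (Fin 3))))
    (f := fun y : EuclideanSpace ℝ (Fin 3) => ⟪e, y⟫) (g := gaussWeight) (v := e) ?_ ?_ ?_
    (fun x _ => ((innerSL ℝ e).differentiableAt).congr_of_eventuallyEq
      (Eventually.of_forall fun y => by simp))
    (fun x _ => (hasFDerivAt_gaussWeight x).differentiableAt)
  · simp_rw [fderiv_inner_right_apply, fderiv_gaussWeight_apply, real_inner_self_eq_norm_sq] at key
    have h1 : ∫ y : EuclideanSpace ℝ (Fin 3), ⟪e, y⟫ * (-(1 / 2 : ℝ) * gaussWeight y * ⟪y, e⟫) =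
        -(1 / 2 : ℝ) * ∫ y : EuclideanSpace ℝ (Fin 3), ⟪e, y⟫ ^ 2 * gaussWeight y := by
      rw [← integral_const_mul]
      refine integral_congr_ae (Eventually.of_forall fun y => ?_)
      simp only [real_inner_comm e y]
      ring
    rw [h1, integral_const_mul] at key
    linarith
  · simp_rw [fderiv_inner_right_apply, real_inner_self_eq_norm_sq]
    exact integrable_gaussWeight.const_mul _
  · simp_rw [fderiv_gaussWeight_apply]
    refine ((integrable_inner_sq_mul_gaussWeight e).const_mul (-(1 / 2 : ℝ))).congr
      (Eventually.of_forall fun y => ?_)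
    simp only [real_inner_comm e y]
    ring
  · exact integrable_inner_mul_gaussWeight e

/-! ### The witness: the self-similar parasitic drift `u = C(-t)^{-1/2} e`

`uniformVel (galAmp C 0) e t x = (C/√(0 - t)) • e`, with the linear pressure
`uniformPres (derivWithin (galAmp C 0) (Iio 0)) e t x = ⟪-(a'(t)) • e, x⟫`, `a(t) = C/√(-t)`. -/

/-- **The drift is a classical Navier–Stokes solution on `(-∞, 0)`** (unit viscosity, no force;
KNSS 2009 §1 p. 3). -/
theorem isClassical_drift (C : ℝ) (e : EuclideanSpace ℝ (Fin 3)) :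
    IsClassicalNSSolutionOn (Iio 0) 1 0 (uniformVel (galAmp C 0) e)
      (uniformPres (derivWithin (galAmp C 0) (Iio 0)) e) :=
  isClassicalNSSolutionOn_uniform (uniqueDiffOn_Iio 0) (contDiffOn_galAmp C 0) 1 e

/-- The drift is jointly smooth on the open slab `(-∞, 0) × ℝ³` (first clause of
`IsTypeIAncientMild`). -/
theorem contDiffOn_drift (C : ℝ) (e : EuclideanSpace ℝ (Fin 3)) :
    ContDiffOn ℝ (⊤ : ℕ∞) (uncurry (uniformVel (galAmp C 0) e)) (Iio 0 ×ˢ univ) :=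
  (isClassical_drift C e).smooth_velocity

/-- The drift has divergence-free slices (second clause of `IsTypeIAncientMild`). -/
theorem isDivFree_drift (C t : ℝ) (e : EuclideanSpace ℝ (Fin 3)) :
    VectorCalculus.IsDivFree (uniformVel (galAmp C 0) e t) :=
  isDivFree_const _

/-- The drift along a unit vector has EXACTLY the Type-I rate, `‖u(t,x)‖ = C/√(-t)` (fourth clause
of `IsTypeIAncientMild`). -/
theorem hasTypeITimeDecay_drift {C : ℝ} (hC : 0 ≤ C) {e : EuclideanSpace ℝ (Fin 3)} (he : ‖e‖ = 1) :
    HasTypeITimeDecay C (uniformVel (galAmp C 0) e) := by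
  intro t _ x
  rw [norm_gal, zero_sub, he, mul_one, abs_of_nonneg hC]

/-- Unfolding the drift: `u(t, x) = (C/√(-t)) • e`. [folklore] -/
theorem drift_apply (C t : ℝ) (e x : EuclideanSpace ℝ (Fin 3)) :
    uniformVel (galAmp C 0) e t x = (C / Real.sqrt (-t)) • e := by
  simp [galAmp]

/-- **The drift fails the Oseen-mild clause** (and only that one): it is slice-constant and
non-zero, while the Oseen gauge kills slice-constant fields
(`IsTypeIAncientMild.eq_zero_of_slice_const`, KNSS 2009 Remark 6.1). -/
theorem not_isTypeIAncientMild_drift {C : ℝ} (hC : 0 < C) {e : EuclideanSpace ℝ (Fin 3)}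
    (he : e ≠ 0) : ¬ IsTypeIAncientMild C (uniformVel (galAmp C 0) e) := by
  intro h
  have key := h.eq_zero_of_slice_const (b := fun t => (C / Real.sqrt (-t)) • e)
    (fun t _ x => drift_apply C t e x) (show (-1 : ℝ) < 0 by norm_num) 0
  rw [drift_apply, neg_neg, Real.sqrt_one, div_one, smul_eq_zero] at key
  exact key.elim hC.ne' he

/-- The derivative of the amplitude `a(t) = C/√(-t)`: `a'(t) = C / (2(-t)√(-t))`. [folklore] -/
theorem hasDerivAt_galAmp_zero (C : ℝ) {t : ℝ} (ht : t < 0) :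
    HasDerivAt (galAmp C 0) (C / (2 * (-t) * Real.sqrt (-t))) t := by
  have hpos : 0 < 0 - t := by linarith
  have hsq : Real.sqrt (0 - t) ≠ 0 := (Real.sqrt_pos.2 hpos).ne'
  have h1 : HasDerivAt (fun s : ℝ => Real.sqrt (0 - s)) ((0 - 1) / (2 * Real.sqrt (0 - t))) t :=
    ((hasDerivAt_const t (0 : ℝ)).sub (hasDerivAt_id t)).sqrt hpos.ne'
  have h2 := (hasDerivAt_const t C).div h1 hsq
  refine h2.congr_deriv ?_
  rw [zero_sub] at hsq ⊢
  have hsq2 : Real.sqrt (-t) ^ 2 = -t := Real.sq_sqrt (by linarith)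
  have ht0 : t ≠ 0 := ht.ne
  rw [hsq2]
  field_simp
  ring

/-- `a'` within the open past equals the derivative. [folklore] -/
theorem derivWithin_galAmp_zero (C : ℝ) {t : ℝ} (ht : t < 0) :
    derivWithin (galAmp C 0) (Iio 0) t = C / (2 * (-t) * Real.sqrt (-t)) := by
  rw [derivWithin_of_isOpen isOpen_Iio ht, (hasDerivAt_galAmp_zero C ht).deriv]

/-- **Similarity variables: the drift is the STEADY Leray profile `U ≡ C e`.** -/
theorem lerayOrbit_drift (C s : ℝ) (e y : EuclideanSpace ℝ (Fin 3)) :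
    lerayOrbit (uniformVel (galAmp C 0) e) s y = C • e := by
  rw [lerayOrbit_apply, drift_apply, neg_neg, sqrt_exp_neg, smul_smul]
  congr 1
  field_simp [(Real.exp_pos (-s / 2)).ne']

/-- The profile is constant in `y`: `∇U = 0`. -/
theorem fderiv_lerayOrbit_drift (C s : ℝ) (e y : EuclideanSpace ℝ (Fin 3)) :
    fderiv ℝ (lerayOrbit (uniformVel (galAmp C 0) e) s) y = 0 := by
  have : lerayOrbit (uniformVel (galAmp C 0) e) s = fun _ => C • e := funext (lerayOrbit_drift C s e)
  rw [this, fderiv_fun_const, Pi.zero_apply]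

/-- **Similarity pressure of the drift: the harmonic linear mode `P = -(C/2)⟪e, y⟫`**
(independent of `s`). -/
theorem lerayOrbitPressure_drift (C s : ℝ) (e y : EuclideanSpace ℝ (Fin 3)) :
    lerayOrbitPressure (uniformPres (derivWithin (galAmp C 0) (Iio 0)) e) s y = -(C / 2) * ⟪e, y⟫ := by
  have ht : -Real.exp (-s) < 0 := neg_neg_of_pos (Real.exp_pos _)
  rw [lerayOrbitPressure_apply, uniformPres_apply, derivWithin_galAmp_zero C ht, neg_neg,
    sqrt_exp_neg, real_inner_smul_left, real_inner_smul_right]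
  have h1 : Real.exp (-s) = Real.exp (-s / 2) * Real.exp (-s / 2) := (exp_neg_half_mul_self s).symm
  rw [h1]
  field_simp [(Real.exp_pos (-s / 2)).ne']

/-! ### The three Gaussian functionals of the witness -/

/-- Gaussian energy of the drift: `E(s) = ½C²‖e‖² ∫γ`. -/
theorem energy_drift (C s : ℝ) (e : EuclideanSpace ℝ (Fin 3)) :
    ∫ y, ‖lerayOrbit (uniformVel (galAmp C 0) e) s y‖ ^ 2 / 2 * Real.exp (-‖y‖ ^ 2 / 4) =
      C ^ 2 * ‖e‖ ^ 2 / 2 * ∫ y : EuclideanSpace ℝ (Fin 3), gaussWeight y := by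
  simp_rw [lerayOrbit_drift, norm_smul, mul_pow, Real.norm_eq_abs, sq_abs, exp_eq_gaussWeight]
  rw [← integral_const_mul]

/-- Gaussian dissipation of the drift: `D(s) = 0`. -/
theorem dissipation_drift (C s : ℝ) (e : EuclideanSpace ℝ (Fin 3)) :
    ∫ y, frobeniusNormSq (fderiv ℝ (lerayOrbit (uniformVel (galAmp C 0) e) s) y) *
      Real.exp (-‖y‖ ^ 2 / 4) = 0 := by
  simp_rw [fderiv_lerayOrbit_drift, frobeniusNormSq_zero, zero_mul, integral_zero]

/-- **Head-flux channel of the drift: `Ch(s) = -C²‖e‖² ∫γ`** — the kinetic part integrates to zero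
(odd moment), the pressure part is `-(C²/2)∫⟪e,y⟫²γ = -C²‖e‖²∫γ`. -/
theorem channel_drift (C s : ℝ) (e : EuclideanSpace ℝ (Fin 3)) :
    ∫ y, (‖lerayOrbit (uniformVel (galAmp C 0) e) s y‖ ^ 2 / 2 +
          lerayOrbitPressure (uniformPres (derivWithin (galAmp C 0) (Iio 0)) e) s y) *
        ⟪y, lerayOrbit (uniformVel (galAmp C 0) e) s y⟫ * Real.exp (-‖y‖ ^ 2 / 4) =
      -(C ^ 2 * ‖e‖ ^ 2 * ∫ y : EuclideanSpace ℝ (Fin 3), gaussWeight y) := by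
  simp_rw [lerayOrbitPressure_drift, lerayOrbit_drift, real_inner_smul_right, norm_smul, mul_pow,
    Real.norm_eq_abs, sq_abs, exp_eq_gaussWeight]
  have h1 : ∀ y : EuclideanSpace ℝ (Fin 3),
      (C ^ 2 * ‖e‖ ^ 2 / 2 + -(C / 2) * ⟪e, y⟫) * (C * ⟪y, e⟫) * gaussWeight y =
        C ^ 3 * ‖e‖ ^ 2 / 2 * (⟪e, y⟫ * gaussWeight y) - C ^ 2 / 2 * (⟪e, y⟫ ^ 2 * gaussWeight y) := by
    intro y
    rw [real_inner_comm e y]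
    ring
  simp_rw [h1]
  rw [integral_sub ((integrable_inner_mul_gaussWeight e).const_mul _)
      ((integrable_inner_sq_mul_gaussWeight e).const_mul _),
    integral_const_mul, integral_const_mul, integral_inner_mul_gaussWeight,
    integral_inner_sq_mul_gaussWeight]
  ring

/-- **The budget is saturated with EQUALITY: `-½Ch(s) = D(s) + E(s)` for every `s`** (tightness
of the head-influx law off the mild class, at every level `C` and along every direction `e`). -/
theorem budget_saturated_drift (C s : ℝ) (e : EuclideanSpace ℝ (Fin 3)) :
    -(∫ y, (‖lerayOrbit (uniformVel (galAmp C 0) e) s y‖ ^ 2 / 2 +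
          lerayOrbitPressure (uniformPres (derivWithin (galAmp C 0) (Iio 0)) e) s y) *
        ⟪y, lerayOrbit (uniformVel (galAmp C 0) e) s y⟫ * Real.exp (-‖y‖ ^ 2 / 4)) / 2 =
      (∫ y, frobeniusNormSq (fderiv ℝ (lerayOrbit (uniformVel (galAmp C 0) e) s) y) *
          Real.exp (-‖y‖ ^ 2 / 4)) +
        ∫ y, ‖lerayOrbit (uniformVel (galAmp C 0) e) s y‖ ^ 2 / 2 * Real.exp (-‖y‖ ^ 2 / 4) := by
  rw [channel_drift, dissipation_drift, energy_drift]
  ring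

/-- **The Gaussian energy identity S2c holds for the drift** (`E` is constant and
`-D - E - ½Ch = 0`): a sign check of the skeleton's lever (GE) on an explicit classical solution. -/
theorem energyIdentity_drift (C s : ℝ) (e : EuclideanSpace ℝ (Fin 3)) :
    HasDerivAt (fun σ : ℝ => ∫ y, ‖lerayOrbit (uniformVel (galAmp C 0) e) σ y‖ ^ 2 / 2 *
        Real.exp (-‖y‖ ^ 2 / 4))
      (-(∫ y, frobeniusNormSq (fderiv ℝ (lerayOrbit (uniformVel (galAmp C 0) e) s) y) *
            Real.exp (-‖y‖ ^ 2 / 4))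
        - (∫ y, ‖lerayOrbit (uniformVel (galAmp C 0) e) s y‖ ^ 2 / 2 * Real.exp (-‖y‖ ^ 2 / 4))
        - (∫ y, (‖lerayOrbit (uniformVel (galAmp C 0) e) s y‖ ^ 2 / 2 +
              lerayOrbitPressure (uniformPres (derivWithin (galAmp C 0) (Iio 0)) e) s y) *
            ⟪y, lerayOrbit (uniformVel (galAmp C 0) e) s y⟫ * Real.exp (-‖y‖ ^ 2 / 4)) / 2) s := by
  simp_rw [energy_drift]
  rw [channel_drift, dissipation_drift]
  have : -(0 : ℝ) - C ^ 2 * ‖e‖ ^ 2 / 2 * (∫ y : EuclideanSpace ℝ (Fin 3), gaussWeight y) -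
      -(C ^ 2 * ‖e‖ ^ 2 * ∫ y : EuclideanSpace ℝ (Fin 3), gaussWeight y) / 2 = 0 := by ring
  rw [this]
  exact hasDerivAt_const s _

/-- **The head-influx law fails for the drift** (`C ≠ 0`, `e ≠ 0`), for every `ε > 0` and every
window length `S₀` (on the window `[0, max S₀ 1]`: influx `= budget > (1-ε)·budget`). -/
theorem law_fails_drift {C : ℝ} (hC : C ≠ 0) {e : EuclideanSpace ℝ (Fin 3)} (he : e ≠ 0) {ε : ℝ}
    (hε : 0 < ε) (S₀ : ℝ) :
    ∃ a b : ℝ, a + S₀ ≤ b ∧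
      ¬ ((∫ s in a..b, -(∫ y, (‖lerayOrbit (uniformVel (galAmp C 0) e) s y‖ ^ 2 / 2 +
              lerayOrbitPressure (uniformPres (derivWithin (galAmp C 0) (Iio 0)) e) s y) *
            ⟪y, lerayOrbit (uniformVel (galAmp C 0) e) s y⟫ * Real.exp (-‖y‖ ^ 2 / 4)) / 2) ≤
          (1 - ε) * ∫ s in a..b,
            ((∫ y, frobeniusNormSq (fderiv ℝ (lerayOrbit (uniformVel (galAmp C 0) e) s) y) *
                Real.exp (-‖y‖ ^ 2 / 4)) +
              ∫ y, ‖lerayOrbit (uniformVel (galAmp C 0) e) s y‖ ^ 2 / 2 *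
                Real.exp (-‖y‖ ^ 2 / 4))) := by
  refine ⟨0, max S₀ 1, by simp, fun h => ?_⟩
  simp_rw [channel_drift, dissipation_drift, energy_drift, intervalIntegral.integral_const,
    smul_eq_mul, sub_zero, zero_add] at h
  have hI : 0 < ∫ y : EuclideanSpace ℝ (Fin 3), gaussWeight y := integral_gaussWeight_pos
  have hb : 0 < max S₀ 1 := lt_max_of_lt_right one_pos
  have hC2 : 0 < C ^ 2 := by positivity
  have he2 : 0 < ‖e‖ ^ 2 := by positivity
  nlinarith [mul_pos (mul_pos hε hb) (mul_pos (mul_pos hC2 he2) hI)]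

/-! ### Main theorem -/

/-- **S4 `stub_headInfluxLaw` is FALSE WITHOUT the Oseen-mild clause of `IsTypeIAncientMild`.**
The statement below is the skeleton's `stub_headInfluxLaw` with `IsTypeIAncientMild C u` replaced
by its other three conjuncts (joint smoothness on `(-∞,0) × ℝ³`, divergence-free slices, Type-I
rate `‖u(t,x)‖ ≤ C/√(-t)`); the classical-pressure hypothesis is kept (the weakened statement
implies S4 verbatim, checked in the seat's `S4Check.lean`). Witness: the self-similar parasitic
drift with `C = 1`, `e = EuclideanSpace.single 0 1` (any `C ≠ 0`, `e ≠ 0` works: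
`law_fails_drift`). So every proof of S4, at every level `C`, must use the Oseen representation
between pairs of times — concretely through the pressure, whose harmonic linear mode carries the
whole influx here. -/
theorem stub_headInfluxLaw_false_without_mild :
    ¬ (∀ (C : ℝ) (u : ℝ → EuclideanSpace ℝ (Fin 3) → EuclideanSpace ℝ (Fin 3))
        (p : ℝ → EuclideanSpace ℝ (Fin 3) → ℝ),
        ContDiffOn ℝ (⊤ : ℕ∞) (uncurry u) (Set.Iio 0 ×ˢ Set.univ) →
        (∀ t < 0, VectorCalculus.IsDivFree (u t)) →
        HasTypeITimeDecay C u →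
        IsClassicalNSSolutionOn (Set.Iio 0) 1 0 u p →
        ∃ ε : ℝ, 0 < ε ∧ ∃ S₀ : ℝ, ∀ a b : ℝ, a + S₀ ≤ b →
          (∫ s in a..b, -(∫ y, (‖lerayOrbit u s y‖ ^ 2 / 2 + lerayOrbitPressure p s y) *
              ⟪y, lerayOrbit u s y⟫ * Real.exp (-‖y‖ ^ 2 / 4)) / 2) ≤
            (1 - ε) * ∫ s in a..b,
              ((∫ y, frobeniusNormSq (fderiv ℝ (lerayOrbit u s) y) * Real.exp (-‖y‖ ^ 2 / 4)) +
                ∫ y, ‖lerayOrbit u s y‖ ^ 2 / 2 * Real.exp (-‖y‖ ^ 2 / 4))) := by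
  intro h
  have he1 : ‖(EuclideanSpace.single 0 1 : EuclideanSpace ℝ (Fin 3))‖ = 1 := by simp
  have he0 : (EuclideanSpace.single 0 1 : EuclideanSpace ℝ (Fin 3)) ≠ 0 := by
    intro h0; rw [h0, norm_zero] at he1; exact zero_ne_one he1
  obtain ⟨ε, hε, S₀, hlaw⟩ := h 1 (uniformVel (galAmp 1 0) (EuclideanSpace.single 0 1))
    (uniformPres (derivWithin (galAmp 1 0) (Iio 0)) (EuclideanSpace.single 0 1))
    (contDiffOn_drift 1 _) (fun t _ => isDivFree_drift 1 t _) (hasTypeITimeDecay_drift zero_le_one he1)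
    (isClassical_drift 1 _)
  obtain ⟨a, b, hab, hfail⟩ := law_fails_drift one_ne_zero he0 hε S₀
  exact hfail (hlaw a b hab)

end Summit.NavierStokesRegularity.NavierStokesRegularity.Theorems.TargetNegative.HeadInfluxLawDrift

end
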